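import Summits.ValiantsHypothesis.ValiantsHypothesis.Theorems.SymPencilPerFourCrossSixForms
import Summits.ValiantsHypothesis.ValiantsHypothesis.Theorems.SymPencilAffineKernelLeverInvariance

/-!
# Route `SymPencil` — the column-deleted two-row space `W_col = rows {0,1} × cols {1,2,3}` at
# size `27`, I: shift identities, the count, and the two levers
# (`--supports` stmt-ValiantsHypothesis-5674 `SdcSuperquadratic`; cell `(10,6,6)` of the size-`27`
# kernel-package table, rung currency only, nothing here bears on `VP ≠ VNP`)

`W_col` is the coordinate `6`-space of `Sing Z(per_4)` with per-direction / per-point Hessian ranks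
`(4, 6)` (`Cruxes/SdcSuperquadratic/PENCIL-CROSS-27.md`, coordinate census); whether it carries a
joint six-square family is open, so the pencil must exclude it.  Complement coordinates:
`x₀₀, x₁₀, x₂₀, x₂' , x₃₀, x₃'`; `Z8 = {x₂₀ = x₃₀ = 0}`; `P_{0m}(x) = x₂₀ x₃ₘ + x₂ₘ x₃₀`.

* `per_shift_colW_a` / `…_b₁` / `…_b₂`: for the affine directions `a = E₀₁+E₀₂+E₀₃`,
  `b₁ = E₁₁+E₁₂+E₁₃`, `b₂ = E₁₁+E₁₂+2E₁₃`, translating by the OTHER row of `W_col` changes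
  `per_4(· + t d) - per_4` by `t · Σ_m (A q)_m P_{0m}`.
* `cols_zero_of_isotropic` (the COUNT): a subspace of the complement coordinates on which the polar
  forms of `P₀₁, P₀₂, P₀₃` vanish has dimension `≤ 8 - 2 dim {(x₂₀, x₃₀)}`; so dimension `≥ 7`
  forces `x₂₀ = x₃₀ = 0`.
* `colW_lever` (MAIN, for each of the three directions `d`): in the base-point package with kernel
  space exactly `W_col`, `|ι'| ≤ 26`, `dim (im bL) ≥ 10`: the space
  `K_d = {y ∈ im bL : C(d) D⁻¹ y ∈ im bL}` satisfies `K_d ≤ B8`, `C(d)D⁻¹ K_d ≤ B8` and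
  `7 ≤ dim K_d`, where `B8 = bL(Z8)` (`SymPencilAffineKernelLever`, `…LeverInvariance`).

The pair argument that finishes `W_col` (no endgame needed) is in `SymPencilPerFourColSix`.
No definitions, no named facts. [folklore]
-/

noncomputable section

-- single-conjunct layout: Sub = Summit, duplicated namespace component intended
set_option linter.dupNamespace false

namespace Summit.ValiantsHypothesis.ValiantsHypothesis.Theorems.SymPencilPerFourColSixForms

open Matrix MvPolynomial Module
open Literature.Computability.AlgebraicComplexity
open Summit.ValiantsHypothesis.ValiantsHypothesis.Theorems.SymPencilLagrangianKernel
open Summit.ValiantsHypothesis.ValiantsHypothesis.Theorems.SymPencilAffineKernelLever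
open Summit.ValiantsHypothesis.ValiantsHypothesis.Theorems.SymPencilAffineKernelLeverInvariance
open Summit.ValiantsHypothesis.ValiantsHypothesis.Theorems.SymPencilSdcPerFourTwentySeven
open Summit.ValiantsHypothesis.ValiantsHypothesis.Theorems.SymPencilPerFourCrossSixForms
open Literature.Computability.AlgebraicComplexity.AlperBogartVelasco

universe u

variable {k : Type u} [Field k]

/-! ### The three shift identities -/

/-- Shift identity for the lever along `a = E₀₁+E₀₂+E₀₃` on `W_col`: translating by
`(0,p₁,p₂,p₃)` in row `1`. [folklore] -/
theorem per_shift_colW_a (x : Fin 4 × Fin 4 → k) (p₁ p₂ p₃ t : k) :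
    MvPolynomial.eval (x + (fun z : Fin 4 × Fin 4 =>
        (Matrix.of ![![0, 0, 0, 0], ![0, p₁, p₂, p₃], ![0, 0, 0, 0], ![0, 0, 0, 0]]) z.1 z.2) +
        t • (fun z : Fin 4 × Fin 4 =>
          (Matrix.of ![![0, 1, 1, 1], ![0, 0, 0, 0], ![0, 0, 0, 0], ![0, 0, 0, 0]]) z.1 z.2))
        (perPoly (Fin 4) k) -
      MvPolynomial.eval (x + (fun z : Fin 4 × Fin 4 =>
        (Matrix.of ![![0, 0, 0, 0], ![0, p₁, p₂, p₃], ![0, 0, 0, 0], ![0, 0, 0, 0]]) z.1 z.2))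
        (perPoly (Fin 4) k) -
      (MvPolynomial.eval (x + t • (fun z : Fin 4 × Fin 4 =>
          (Matrix.of ![![0, 1, 1, 1], ![0, 0, 0, 0], ![0, 0, 0, 0], ![0, 0, 0, 0]]) z.1 z.2))
          (perPoly (Fin 4) k) - MvPolynomial.eval x (perPoly (Fin 4) k)) =
      t * (p₁ * ((x (2, 0) * x (3, 2) + x (2, 2) * x (3, 0)) + (x (2, 0) * x (3, 3) + x (2, 3) * x (3, 0))) +
        p₂ * ((x (2, 0) * x (3, 1) + x (2, 1) * x (3, 0)) + (x (2, 0) * x (3, 3) + x (2, 3) * x (3, 0))) +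
        p₃ * ((x (2, 0) * x (3, 1) + x (2, 1) * x (3, 0)) + (x (2, 0) * x (3, 2) + x (2, 2) * x (3, 0)))) := by
  simp only [eval_perPoly, Matrix.permanent_fin_four_row, Matrix.of_apply, Pi.add_apply,
    Pi.smul_apply, smul_eq_mul]
  simp
  ring

/-- Shift identity for the lever along `b₁ = E₁₁+E₁₂+E₁₃`: translating by `(0,q₁,q₂,q₃)` in row `0`.
[folklore] -/
theorem per_shift_colW_b₁ (x : Fin 4 × Fin 4 → k) (q₁ q₂ q₃ t : k) :
    MvPolynomial.eval (x + (fun z : Fin 4 × Fin 4 =>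
        (Matrix.of ![![0, q₁, q₂, q₃], ![0, 0, 0, 0], ![0, 0, 0, 0], ![0, 0, 0, 0]]) z.1 z.2) +
        t • (fun z : Fin 4 × Fin 4 =>
          (Matrix.of ![![0, 0, 0, 0], ![0, 1, 1, 1], ![0, 0, 0, 0], ![0, 0, 0, 0]]) z.1 z.2))
        (perPoly (Fin 4) k) -
      MvPolynomial.eval (x + (fun z : Fin 4 × Fin 4 =>
        (Matrix.of ![![0, q₁, q₂, q₃], ![0, 0, 0, 0], ![0, 0, 0, 0], ![0, 0, 0, 0]]) z.1 z.2))
        (perPoly (Fin 4) k) -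
      (MvPolynomial.eval (x + t • (fun z : Fin 4 × Fin 4 =>
          (Matrix.of ![![0, 0, 0, 0], ![0, 1, 1, 1], ![0, 0, 0, 0], ![0, 0, 0, 0]]) z.1 z.2))
          (perPoly (Fin 4) k) - MvPolynomial.eval x (perPoly (Fin 4) k)) =
      t * (q₁ * ((x (2, 0) * x (3, 2) + x (2, 2) * x (3, 0)) + (x (2, 0) * x (3, 3) + x (2, 3) * x (3, 0))) +
        q₂ * ((x (2, 0) * x (3, 1) + x (2, 1) * x (3, 0)) + (x (2, 0) * x (3, 3) + x (2, 3) * x (3, 0))) +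
        q₃ * ((x (2, 0) * x (3, 1) + x (2, 1) * x (3, 0)) + (x (2, 0) * x (3, 2) + x (2, 2) * x (3, 0)))) := by
  simp only [eval_perPoly, Matrix.permanent_fin_four_row, Matrix.of_apply, Pi.add_apply,
    Pi.smul_apply, smul_eq_mul]
  simp
  ring

/-- Shift identity for the lever along `b₂ = E₁₁+E₁₂+2E₁₃`: translating by `(0,q₁,q₂,q₃)` in row
`0`. [folklore] -/
theorem per_shift_colW_b₂ (x : Fin 4 × Fin 4 → k) (q₁ q₂ q₃ t : k) :
    MvPolynomial.eval (x + (fun z : Fin 4 × Fin 4 =>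
        (Matrix.of ![![0, q₁, q₂, q₃], ![0, 0, 0, 0], ![0, 0, 0, 0], ![0, 0, 0, 0]]) z.1 z.2) +
        t • (fun z : Fin 4 × Fin 4 =>
          (Matrix.of ![![0, 0, 0, 0], ![0, 1, 1, 2], ![0, 0, 0, 0], ![0, 0, 0, 0]]) z.1 z.2))
        (perPoly (Fin 4) k) -
      MvPolynomial.eval (x + (fun z : Fin 4 × Fin 4 =>
        (Matrix.of ![![0, q₁, q₂, q₃], ![0, 0, 0, 0], ![0, 0, 0, 0], ![0, 0, 0, 0]]) z.1 z.2))
        (perPoly (Fin 4) k) -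
      (MvPolynomial.eval (x + t • (fun z : Fin 4 × Fin 4 =>
          (Matrix.of ![![0, 0, 0, 0], ![0, 1, 1, 2], ![0, 0, 0, 0], ![0, 0, 0, 0]]) z.1 z.2))
          (perPoly (Fin 4) k) - MvPolynomial.eval x (perPoly (Fin 4) k)) =
      t * (q₁ * ((x (2, 0) * x (3, 3) + x (2, 3) * x (3, 0)) + 2 * (x (2, 0) * x (3, 2) + x (2, 2) * x (3, 0))) +
        q₂ * ((x (2, 0) * x (3, 3) + x (2, 3) * x (3, 0)) + 2 * (x (2, 0) * x (3, 1) + x (2, 1) * x (3, 0))) +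
        q₃ * ((x (2, 0) * x (3, 1) + x (2, 1) * x (3, 0)) + (x (2, 0) * x (3, 2) + x (2, 2) * x (3, 0)))) := by
  simp only [eval_perPoly, Matrix.permanent_fin_four_row, Matrix.of_apply, Pi.add_apply,
    Pi.smul_apply, smul_eq_mul]
  simp
  ring

/-! ### The count -/

/-- **The count for `W_col`.**  A subspace of the complement coordinates of `W_col` on which the
polar forms of `P₀₁, P₀₂, P₀₃` (`P_{0m}(x) = x₂₀x₃ₘ + x₂ₘx₃₀`) vanish has dimension
`≤ 8 - 2 dim{(x₂₀, x₃₀)}`; so dimension `≥ 7` forces `x₂₀ = x₃₀ = 0`. [folklore] -/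
theorem cols_zero_of_isotropic (S : Submodule k (Fin 4 × Fin 4 → k))
    (hX : ∀ x ∈ S, ∀ z : Fin 4 × Fin 4, (z.1 = 0 ∨ z.1 = 1) → z.2 ≠ 0 → x z = 0)
    (hP : ∀ m : Fin 3, ∀ x ∈ S, ∀ x' ∈ S,
      x (2, 0) * x' (3, m.succ) + x' (2, 0) * x (3, m.succ) + x (2, m.succ) * x' (3, 0) +
        x' (2, m.succ) * x (3, 0) = 0)
    (h7 : 7 ≤ finrank k S) : ∀ x ∈ S, x (2, 0) = 0 ∧ x (3, 0) = 0 := by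
  classical
  set γ : (Fin 4 × Fin 4 → k) →ₗ[k] (Fin 2 → k) :=
    LinearMap.funLeft k k (![((2 : Fin 4), (0 : Fin 4)), ((3 : Fin 4), (0 : Fin 4))] :
      Fin 2 → Fin 4 × Fin 4) with hγdef
  have hγ0 : ∀ x, γ x 0 = x (2, 0) := fun x => rfl
  have hγ1 : ∀ x, γ x 1 = x (3, 0) := fun x => rfl
  set ρ : Fin 3 → (Fin 4 × Fin 4 → k) →ₗ[k] (Fin 2 → k) := fun m =>
    LinearMap.funLeft k k (![((3 : Fin 4), m.succ), ((2 : Fin 4), m.succ)] : Fin 2 → Fin 4 × Fin 4)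
    with hρdef
  have hρ0 : ∀ m x, ρ m x 0 = x (3, m.succ) := fun m x => rfl
  have hρ1 : ∀ m x, ρ m x 1 = x (2, m.succ) := fun m x => rfl
  set e : (Fin 4 × Fin 4 → k) →ₗ[k] (Fin 2 → k) :=
    LinearMap.funLeft k k (![((0 : Fin 4), (0 : Fin 4)), ((1 : Fin 4), (0 : Fin 4))] :
      Fin 2 → Fin 4 × Fin 4) with hedef
  have he0 : ∀ x, e x 0 = x (0, 0) := fun x => rfl
  have he1 : ∀ x, e x 1 = x (1, 0) := fun x => rfl
  -- `W` and its dot-orthogonal in `k²`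
  set W := S.map γ with hWdef
  set Bd : LinearMap.BilinForm k (Fin 2 → k) := Matrix.toBilin' (1 : Matrix (Fin 2) (Fin 2) k)
    with hBd
  have hBd_apply : ∀ v w : Fin 2 → k, Bd v w = v ⬝ᵥ w := fun v w => by
    rw [hBd, Matrix.toBilin'_apply', Matrix.one_mulVec]
  have hnd : Bd.Nondegenerate :=
    LinearMap.BilinForm.nondegenerate_toBilin'_of_det_ne_zero' _ (by simp)
  set Wp := Bd.orthogonal W with hWp
  have hWp_mem : ∀ c : Fin 2 → k, (∀ x' ∈ S, γ x' ⬝ᵥ c = 0) → c ∈ Wp := by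
    intro c hc
    rw [hWp, LinearMap.BilinForm.mem_orthogonal_iff]
    rintro _ ⟨x', hx', rfl⟩
    show Bd (γ x') c = 0
    rw [hBd_apply]
    exact hc x' hx'
  have h2 : finrank k (Fin 2 → k) = 2 := by simp
  have hWle : finrank k W ≤ 2 := by
    have := Submodule.finrank_le W
    rwa [h2] at this
  have hWp_dim : finrank k Wp = 2 - finrank k W := by
    have := LinearMap.BilinForm.finrank_orthogonal hnd W
    rwa [h2] at this
  -- the chain
  set S₀ := (S ⊓ LinearMap.ker γ : Submodule k (Fin 4 × Fin 4 → k)) with hS₀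
  set S₁ := (S₀ ⊓ LinearMap.ker (ρ 0) : Submodule k (Fin 4 × Fin 4 → k)) with hS₁
  set S₂ := (S₁ ⊓ LinearMap.ker (ρ 1) : Submodule k (Fin 4 × Fin 4 → k)) with hS₂
  set S₃ := (S₂ ⊓ LinearMap.ker (ρ 2) : Submodule k (Fin 4 × Fin 4 → k)) with hS₃
  have ha := AlperBogartVelasco.finrank_eq_finrank_map_add_finrank_inf_ker S γ
  have hb := AlperBogartVelasco.finrank_eq_finrank_map_add_finrank_inf_ker S₀ (ρ 0)
  have hc := AlperBogartVelasco.finrank_eq_finrank_map_add_finrank_inf_ker S₁ (ρ 1)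
  have hd := AlperBogartVelasco.finrank_eq_finrank_map_add_finrank_inf_ker S₂ (ρ 2)
  have hf := AlperBogartVelasco.finrank_eq_finrank_map_add_finrank_inf_ker S₃ e
  rw [← hS₀, ← hWdef] at ha
  rw [← hS₁] at hb
  rw [← hS₂] at hc
  rw [← hS₃] at hd
  have hS₀_γ : ∀ x ∈ S₀, x (2, 0) = 0 ∧ x (3, 0) = 0 := fun x hx => by
    have h := (Submodule.mem_inf.1 hx).2
    rw [LinearMap.mem_ker] at h
    exact ⟨by rw [← hγ0 x, h, Pi.zero_apply], by rw [← hγ1 x, h, Pi.zero_apply]⟩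
  have hS₁le : S₁ ≤ S₀ := inf_le_left
  have hS₂le : S₂ ≤ S₀ := inf_le_left.trans hS₁le
  -- `ρ m (S₀) ≤ W⊥`
  have hρle : ∀ m : Fin 3, ∀ T : Submodule k (Fin 4 × Fin 4 → k), T ≤ S₀ →
      finrank k (T.map (ρ m)) ≤ finrank k Wp := by
    intro m T hT
    apply Submodule.finrank_mono
    rintro _ ⟨x, hx, rfl⟩
    apply hWp_mem
    intro x' hx'
    have hx₀ := hT hx
    obtain ⟨h20, h30⟩ := hS₀_γ x hx₀
    have h := hP m x (Submodule.mem_inf.1 hx₀).1 x' hx'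
    rw [h20, h30, zero_mul, mul_zero, zero_add, add_zero] at h
    rw [dotProduct, Fin.sum_univ_two, hγ0, hγ1, hρ0, hρ1]
    linear_combination h
  have hb' := hρle 0 S₀ le_rfl
  have hc' := hρle 1 S₁ hS₁le
  have hd' := hρle 2 S₂ hS₂le
  -- `e (S₃)` has dimension `≤ 2` and `S₃ ∩ ker e = 0`
  have hf' : finrank k (S₃.map e) ≤ 2 := by
    have := Submodule.finrank_le (S₃.map e)
    rwa [h2] at this
  have hbot : (S₃ ⊓ LinearMap.ker e : Submodule k (Fin 4 × Fin 4 → k)) = ⊥ := by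
    rw [Submodule.eq_bot_iff]
    intro x hx
    obtain ⟨hx3, hxe⟩ := Submodule.mem_inf.1 hx
    obtain ⟨hx2, hxρ2⟩ := Submodule.mem_inf.1 hx3
    obtain ⟨hx1, hxρ1⟩ := Submodule.mem_inf.1 hx2
    obtain ⟨hx0, hxρ0⟩ := Submodule.mem_inf.1 hx1
    have hxS : x ∈ S := (Submodule.mem_inf.1 hx0).1
    obtain ⟨h20, h30⟩ := hS₀_γ x hx0
    rw [LinearMap.mem_ker] at hxe hxρ0 hxρ1 hxρ2
    have h00 : x (0, 0) = 0 := by rw [← he0 x, hxe, Pi.zero_apply]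
    have h10 : x (1, 0) = 0 := by rw [← he1 x, hxe, Pi.zero_apply]
    have h31 : x (3, 1) = 0 := by
      have h' := hρ0 0 x; rw [hxρ0, Pi.zero_apply] at h'; simpa using h'.symm
    have h21 : x (2, 1) = 0 := by
      have h' := hρ1 0 x; rw [hxρ0, Pi.zero_apply] at h'; simpa using h'.symm
    have h32 : x (3, 2) = 0 := by
      have h' := hρ0 1 x; rw [hxρ1, Pi.zero_apply] at h'; simpa using h'.symm
    have h22 : x (2, 2) = 0 := by
      have h' := hρ1 1 x; rw [hxρ1, Pi.zero_apply] at h'; simpa using h'.symm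
    have h33 : x (3, 3) = 0 := by
      have h' := hρ0 2 x; rw [hxρ2, Pi.zero_apply] at h'; simpa using h'.symm
    have h23 : x (2, 3) = 0 := by
      have h' := hρ1 2 x; rw [hxρ2, Pi.zero_apply] at h'; simpa using h'.symm
    funext z
    obtain ⟨i, j⟩ := z
    rw [Pi.zero_apply]
    fin_cases i <;> fin_cases j
    · exact h00
    · exact hX x hxS _ (Or.inl rfl) (by decide)
    · exact hX x hxS _ (Or.inl rfl) (by decide)
    · exact hX x hxS _ (Or.inl rfl) (by decide)
    · exact h10
    · exact hX x hxS _ (Or.inr rfl) (by decide)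
    · exact hX x hxS _ (Or.inr rfl) (by decide)
    · exact hX x hxS _ (Or.inr rfl) (by decide)
    · exact h20
    · exact h21
    · exact h22
    · exact h23
    · exact h30
    · exact h31
    · exact h32
    · exact h33
  rw [hbot, finrank_bot, add_zero] at hf
  have hW0 : finrank k W = 0 := by omega
  have hWbot : W = ⊥ := Submodule.finrank_eq_zero.1 hW0
  intro x hx
  have hmem : γ x ∈ W := ⟨x, hx, rfl⟩
  rw [hWbot, Submodule.mem_bot] at hmem
  exact ⟨by rw [← hγ0 x, hmem, Pi.zero_apply], by rw [← hγ1 x, hmem, Pi.zero_apply]⟩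

end Summit.ValiantsHypothesis.ValiantsHypothesis.Theorems.SymPencilPerFourColSixForms

end
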